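import Literature.GroupTheory.CombinatorialGroupTheory.SchreierRibbonGraphPrelim
import Literature.GroupTheory.CombinatorialGroupTheory.FaceSystemCoverings
import Literature.GroupTheory.CombinatorialGroupTheory.SchreierTreeFreeBasis
import Literature.GroupTheory.CombinatorialGroupTheory.TreeContraction
import Literature.GroupTheory.CombinatorialGroupTheory.CosetOrbitDoubleCosets
import HarnessLib

/-!
# The Schreier ribbon graph of a finite-index subgroup of a free group over a one-vertex face system

Topic `Literature/GroupTheory/CombinatorialGroupTheory`; theorems only.  Continues
`SchreierRibbonGraphFaces.lean` / `SchreierRibbonGraphPrelim.lean` and assembles the (S) = SCHREIER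
layer of the cell's theorem on finite-index subgroups of punctured surface groups
(`PuncturedSurfaceGroupFiniteIndexSubgroup`; Hoare–Karrass–Solitar 1971 Thm. 1, ZVC Thm. 4.14.1):
the statement `exists_schreierRibbonGraph` is the (S)-shape agreed in the cell VERBATIM.

For `X` finite, `S` a ONE-VERTEX FACE SYSTEM over `X × Bool` (letters pairwise distinct and
exhaustive, faces nonempty, `sysPerm S` transitive — a bouquet of `|X|` circles thickened to a ribbon
graph with boundary faces `S`) and `K ≤ F(X)` of finite index, the covering ribbon graph of `K` has
vertices `A = F(X)/K`, edges `X × A`, and over the base face `L ∈ S` one boundary face per orbit `ω`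
of `c = mk L` on `A`, reading the lift of `L^{m_ω}` (`SchreierRibbonGraphFaces.lean`).  Contracting
the breadth-first Schreier tree `𝒯` and reading the faces in Schreier's basis `Φ : F({e ∉ 𝒯}) ≃* K`
(`SchreierTreeFreeBasis.lean`) gives:

* a one-vertex face system `Fs` over `E × Bool`, `E = {non-tree edges}`, with
  `#E + [F:K] = [F:K]·#X + 1`;
* the face over `(L, ω)` has `Φ`-value `rep · c^{m_ω} · rep⁻¹` with `rep = t(b_ω)⁻¹` (`t` the tree
  transversal, `b_ω` a vertex of the orbit), `rep · cⁿ · rep⁻¹ ∈ K ↔ m_ω ∣ n`, and the faces over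
  `L` correspond exactly to the double cosets `K \ F(X) / ⟨c⟩` (`CosetOrbitDoubleCosets.lean`).

One vertex: the cycles of the vertex permutation of the orbit faces are the fibres of the end-vertex
map (`sameCycle_sysPerm_iff_of_covering`); contracting the tree merges them
(`sysPerm_mul_delPerm_transitive_of_tree`, `sameCycle_sysPerm_filter`, `sameCycle_sysPerm_of_inclLetter`).
No contracted face is empty: its `Φ`-value is a conjugate of `c^{m_ω} ≠ 1`.

## References

* A. H. M. Hoare, A. Karrass, D. Solitar, *Subgroups of finite index of Fuchsian groups*,
  Math. Z. 120 (1971) 289–298, Thm. 1 (proof). [HoareKarrassSolitar1971]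
* H. Zieschang, E. Vogt, H.-D. Coldewey, *Surfaces and Planar Discontinuous Groups*, LNM 835,
  Springer 1980, 2.2.2–2.2.4, 3.1.2, 3.1.6, Thm. 4.14.1. [ZieschangVogtColdewey1980]
-/

namespace Literature.GroupTheory.CombinatorialGroupTheory

open List Equiv Equiv.Perm CoveringPresentation

/-! ### Small helpers -/

/-- A face system with pairwise distinct letters and nonempty faces has pairwise distinct faces.
[cite: ZieschangVogtColdewey1980, 3.1.2] -/
theorem nodup_of_nodup_flatten {α : Type*} {S : List (List α)} (hd : S.flatten.Nodup)
    (hne : ∀ F ∈ S, F ≠ []) : S.Nodup := by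
  refine List.Pairwise.imp_of_mem (fun {F G} hF _ hFG => ?_) (nodup_flatten.1 hd).2
  rintro rfl
  obtain ⟨x, hx⟩ := exists_mem_of_ne_nil F (hne F hF)
  exact hFG hx hx

/-- In a face system with pairwise distinct letters, two faces sharing a letter are equal.
[cite: ZieschangVogtColdewey1980, 3.1.2] -/
theorem eq_of_mem_of_mem_of_nodup_flatten {α : Type*} {S : List (List α)} (hd : S.flatten.Nodup)
    {F G : List α} (hF : F ∈ S) (hG : G ∈ S) {x : α} (hxF : x ∈ F) (hxG : x ∈ G) : F = G := by
  by_contra h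
  haveI : Std.Symm (fun F G : List α => Disjoint F G) := ⟨fun _ _ h => h.symm⟩
  exact (nodup_flatten.1 hd).2.forall hF hG h hxF hxG

/-- **Positions along a cyclic orbit are determined by the point**: if `(c^k₁)⁻¹ • b = (c^k₂)⁻¹ • b`
with `k₁, k₂` below the orbit length of `b`, then `k₁ = k₂`. [cite: ZieschangVogtColdewey1980, Thm 4.14.1 p.150] -/
theorem eq_of_inv_pow_smul_eq {G α : Type*} [Group G] [MulAction G α] (c : G) (b : α) {k₁ k₂ : ℕ}
    (hk₁ : k₁ < Function.minimalPeriod (c • ·) b) (hk₂ : k₂ < Function.minimalPeriod (c • ·) b)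
    (h : (c ^ k₁)⁻¹ • b = (c ^ k₂)⁻¹ • b) : k₁ = k₂ := by
  wlog hle : k₁ ≤ k₂ generalizing k₁ k₂
  · exact (this hk₂ hk₁ h.symm (le_of_not_ge hle)).symm
  have hfix : c ^ (k₂ - k₁) • b = b := by
    have e : c ^ k₂ = c ^ (k₂ - k₁) * c ^ k₁ := by rw [← pow_add, Nat.sub_add_cancel hle]
    calc c ^ (k₂ - k₁) • b = c ^ (k₂ - k₁) • (c ^ k₁ • ((c ^ k₁)⁻¹ • b)) := by rw [smul_inv_smul]
      _ = c ^ k₂ • ((c ^ k₂)⁻¹ • b) := by rw [smul_smul, ← e, h]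
      _ = b := smul_inv_smul _ _
  have hdvd := (MulAction.pow_smul_eq_iff_minimalPeriod_dvd).1 hfix
  have := Nat.eq_zero_of_dvd_of_lt hdvd (by omega)
  omega

/-! ### The theorem -/

/-- **The Schreier ribbon graph of a finite-index subgroup of a free group over a one-vertex face
system** (Hoare–Karrass–Solitar 1971, proof of Thm. 1; ZVC Thm. 4.14.1): for `X` finite, a
one-vertex face system `S` over `X × Bool` (letters pairwise distinct and exhaustive, faces nonempty,
`sysPerm S` transitive) and `K ≤ F(X)` of finite index there are a finite type `E` (the non-tree
edges of the covering), an isomorphism `Φ : F(E) ≃* K` (Schreier's basis), and a ONE-VERTEX face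
system `Fs` over `E × Bool` (the boundary faces of the covering ribbon graph with a spanning tree
contracted) with `#E + [F:K] = [F:K]·#X + 1`, whose `i`-th face lies over the base face `face i`,
has `Φ`-value `rep i · c^{m i} · (rep i)⁻¹` (`c = mk (S.get (face i))`, `m i ≥ 1`) with
`rep i · cⁿ · (rep i)⁻¹ ∈ K ↔ m i ∣ n`, the faces over each base face `f` corresponding exactly to the
double cosets `K · δ · ⟨c_f⟩` (Hoare–Karrass–Solitar 1971, Thm. 1).
[cite: ZieschangVogtColdewey1980, Thm 4.14.1 p.150] -/
theorem exists_schreierRibbonGraph :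
    ∀ {X : Type} [Fintype X] [DecidableEq X]
    (S : List (List (X × Bool))), S.flatten.Nodup → (∀ x, x ∈ S.flatten) → (∀ F ∈ S, F ≠ []) →
    (∀ x y, (sysPerm S).SameCycle x y) →
    ∀ (K : Subgroup (FreeGroup X)), K.FiniteIndex →
    ∃ (E : Type) (_ : Fintype E) (_ : DecidableEq E) (Φ : FreeGroup E ≃* K)
      (Fs : List (List (E × Bool)))
      (face : Fin Fs.length → Fin S.length) (rep : Fin Fs.length → FreeGroup X)
      (m : Fin Fs.length → ℕ),
      Fs.flatten.Nodup ∧ (∀ l, l ∈ Fs.flatten) ∧ (∀ W ∈ Fs, W ≠ []) ∧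
      (∀ l l', (sysPerm Fs).SameCycle l l') ∧
      Fintype.card E + K.index = K.index * Fintype.card X + 1 ∧
      (∀ i, 0 < m i ∧
        ((Φ (FreeGroup.mk (Fs.get i)) : FreeGroup X) =
          rep i * FreeGroup.mk (S.get (face i)) ^ (m i) * (rep i)⁻¹) ∧
        (∀ n : ℤ, rep i * FreeGroup.mk (S.get (face i)) ^ n * (rep i)⁻¹ ∈ K ↔ (m i : ℤ) ∣ n)) ∧
      (∀ (f : Fin S.length) (δ : FreeGroup X), ∃! i : Fin Fs.length, face i = f ∧
        ∃ k ∈ K, ∃ z ∈ Subgroup.zpowers (FreeGroup.mk (S.get f)), rep i = k * δ * z) := by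
  intro X _ _ S hSd hSall hSne hStr K hK
  classical
  haveI : Fintype (FreeGroup X ⧸ K) := Subgroup.fintypeQuotientOfFiniteIndex
  set A := FreeGroup X ⧸ K with hA
  set act : FreeGroup X →* Perm A := MulAction.toPermHom (FreeGroup X) A with hact_def
  have hact : ∀ (f : FreeGroup X) (b : A), act f b = f • b := fun _ _ => rfl
  set a₀ : A := ((1 : FreeGroup X) : A) with ha₀
  have hcoe : ∀ f : FreeGroup X, act f a₀ = (f : A) := fun f => by
    rw [hact, ha₀, MulAction.Quotient.smul_coe, smul_eq_mul, mul_one]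
  have hKst : ∀ f, f ∈ K ↔ act f a₀ = a₀ := fun f => by
    rw [hcoe, ha₀, QuotientGroup.eq, mul_one, Subgroup.inv_mem_iff]
  have htr : IsTransitiveFrom act a₀ := fun b => by
    induction b using QuotientGroup.induction_on with
    | H γ => exact ⟨γ.toWord, by rw [FreeGroup.mk_toWord, hcoe]⟩
  have hAcard : Fintype.card A = K.index := by
    rw [Subgroup.index_eq_card, Nat.card_eq_fintype_card]
  set 𝒯 : SchreierTree act a₀ := bfsTree htr with h𝒯
  set T : Set (X × A) := 𝒯.edges with hT
  obtain ⟨Φ, hΦ, -⟩ := exists_mulEquiv_nonTreeEdges 𝒯 K hKst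
  refine ⟨{e : X × A // e ∉ T}, inferInstance, inferInstance, Φ, ?_⟩
  have hLmem : ∀ f : Fin S.length, S.get f ∈ S := fun f => List.get_mem S f
  have hLd : ∀ f : Fin S.length, (S.get f).Nodup := fun f => (nodup_flatten.1 hSd).1 _ (hLmem f)
  have hLne : ∀ f : Fin S.length, S.get f ≠ [] := fun f => hSne _ (hLmem f)
  set c : Fin S.length → FreeGroup X := fun f => FreeGroup.mk (S.get f) with hc
  let Ω : Fin S.length → Type := fun f => MulAction.orbitRel.Quotient (Subgroup.zpowers (c f)) A
  let I : Type := Σ f, Ω f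
  set bpt : I → A := fun i => Quotient.out i.2 with hbpt
  set per : I → ℕ := fun i => Function.minimalPeriod (c i.1 • ·) (bpt i) with hper
  set W : I → List ((X × A) × Bool) := fun i =>
    liftAt act (List.replicate (per i) (S.get i.1)).flatten (bpt i) with hW
  have hper_pos : ∀ i, 0 < per i := fun i => CosetOrbits.minimalPeriod_pos' K (c i.1) (bpt i)
  have hfix : ∀ i, act (c i.1 ^ per i) (bpt i) = bpt i := fun i => by
    rw [hact]; exact MulAction.pow_smul_eq_iff_minimalPeriod_dvd.2 dvd_rfl
  have hWd : ∀ i, (W i).Nodup := fun i => by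
    refine nodup_orbitFace act (hLd i.1) (bpt i) fun k₁ k₂ hk₁ hk₂ h => ?_
    rw [hact, hact] at h
    exact eq_of_inv_pow_smul_eq (c i.1) (bpt i) hk₁ hk₂ h
  have hlenW : ∀ i, (W i).length = per i * (S.get i.1).length := fun i => length_orbitFace act _ _ _
  have hdisj : ∀ i j : I, i ≠ j → Disjoint (W i) (W j) := by
    intro i j hij l hli hlj
    obtain ⟨k₁, j₁, hj₁, hk₁, h₁⟩ := (mem_orbitFace_iff act _ _ _ l).1 hli
    obtain ⟨k₂, j₂, hj₂, hk₂, h₂⟩ := (mem_orbitFace_iff act _ _ _ l).1 hlj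
    have hp := (congrArg proj h₁).symm.trans (congrArg proj h₂)
    rw [proj_edgeLetter, proj_edgeLetter] at hp
    obtain ⟨f₁, ω₁⟩ := i
    obtain ⟨f₂, ω₂⟩ := j
    have hf : f₁ = f₂ := by
      have hL : S.get f₁ = S.get f₂ :=
        eq_of_mem_of_mem_of_nodup_flatten hSd (hLmem f₁) (hLmem f₂) (getElem_mem hj₁) (hp ▸ getElem_mem hj₂)
      exact (nodup_of_nodup_flatten hSd hSne).get_inj_iff.1 hL
    subst hf
    have hjj : j₁ = j₂ := (hLd f₁).getElem_inj_iff.1 hp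
    subst hjj
    have hv := (congrArg (fin act) h₁).symm.trans (congrArg (fin act) h₂)
    rw [fin_edgeLetter, fin_edgeLetter, mul_inv_rev, mul_inv_rev, map_mul, map_mul, Perm.mul_apply,
      Perm.mul_apply] at hv
    have hv' := (act (FreeGroup.mk ((S.get f₁).take j₁))⁻¹).injective hv
    simp only [hact] at hv'
    rw [inv_smul_eq_iff, smul_smul] at hv'
    -- `bpt ⟨f₁, ω₁⟩ = (c^k₁ (c^k₂)⁻¹) • bpt ⟨f₁, ω₂⟩`
    have e : c f₁ ^ k₁ * (c f₁ ^ k₂)⁻¹ = c f₁ ^ ((k₁ : ℤ) - k₂) := by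
      rw [zpow_sub, zpow_natCast, zpow_natCast]
    rw [e] at hv'
    have hω : ω₁ = ω₂ := by
      rw [← Quotient.out_eq ω₁, ← Quotient.out_eq ω₂]
      exact Quotient.sound (MulAction.orbitRel_apply.2 (MulAction.mem_orbit_iff.2
        ⟨⟨c f₁ ^ ((k₁ : ℤ) - k₂), Subgroup.zpow_mem_zpowers _ _⟩, hv'.symm⟩))
    exact hij (by rw [hω])
  set N := Fintype.card I with hN
  set ε : I ≃ Fin N := Fintype.equivFin I with hε
  set Fs₀ : List (List ((X × A) × Bool)) := List.ofFn fun j => W (ε.symm j) with hFs₀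
  have hmemFs₀ : ∀ V, V ∈ Fs₀ ↔ ∃ i, W i = V := fun V => by
    rw [hFs₀, List.mem_ofFn]
    exact ⟨fun ⟨j, hj⟩ => ⟨_, hj⟩, fun ⟨i, hi⟩ => ⟨ε i, by rw [Equiv.symm_apply_apply]; exact hi⟩⟩
  have hd0 : Fs₀.flatten.Nodup := by
    rw [nodup_flatten]
    refine ⟨fun V hV => ?_, ?_⟩
    · obtain ⟨i, rfl⟩ := (hmemFs₀ V).1 hV
      exact hWd i
    · rw [hFs₀, List.pairwise_ofFn]
      intro j₁ j₂ hlt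
      exact hdisj _ _ fun h => (ne_of_lt hlt) (ε.symm.injective h)
  have hSlen : S.flatten.length = Fintype.card (X × Bool) := by
    rw [← List.toFinset_card_of_nodup hSd, Finset.eq_univ_of_forall fun β => List.mem_toFinset.2 (hSall β),
      Finset.card_univ]
  have hsumS : ∑ f : Fin S.length, (S.get f).length = S.flatten.length := by
    rw [List.length_flatten, ← List.sum_ofFn]
    congr 1
    conv_rhs => rw [← List.ofFn_get S]
    rw [List.map_ofFn]
    rfl
  have hlen0 : Fs₀.flatten.length = Fintype.card ((X × A) × Bool) := by
    rw [List.length_flatten, hFs₀, List.map_ofFn, List.sum_ofFn]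
    have e1 : ∑ j : Fin N, (List.length ∘ fun j => W (ε.symm j)) j = ∑ i : I, (W i).length :=
      Equiv.sum_comp ε.symm (fun i => (W i).length)
    rw [e1]
    simp only [hlenW]
    rw [← Finset.univ_sigma_univ, Finset.sum_sigma]
    have e2 : ∀ f : Fin S.length, ∑ ω : Ω f, per ⟨f, ω⟩ * (S.get f).length = K.index * (S.get f).length := by
      intro f
      rw [← Finset.sum_mul, ← CosetOrbits.sum_minimalPeriod_eq_index K (c f)]
    simp only [e2]
    rw [← Finset.mul_sum, hsumS, hSlen, Fintype.card_prod, Fintype.card_prod, Fintype.card_prod, hAcard]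
    ring
  have hall0 : ∀ l, l ∈ Fs₀.flatten := by
    have hcard : Fs₀.flatten.toFinset = Finset.univ := by
      apply Finset.eq_univ_of_card
      rw [List.toFinset_card_of_nodup hd0, hlen0]
    intro l
    have := Finset.mem_univ l
    rw [← hcard, List.mem_toFinset] at this
    exact this
  have hface_of_mem : ∀ l, ∃ i, l ∈ W i := fun l => by
    obtain ⟨V, hV, hl⟩ := mem_flatten.1 (hall0 l)
    obtain ⟨i, rfl⟩ := (hmemFs₀ V).1 hV
    exact ⟨i, hl⟩
  have hprojmem : ∀ i, ∀ l ∈ W i, proj l ∈ S.get i.1 := fun i l hl => by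
    have h := map_proj_liftAt act (List.replicate (per i) (S.get i.1)).flatten (bpt i)
    have : proj l ∈ (List.replicate (per i) (S.get i.1)).flatten := by
      rw [← h]; exact mem_map.2 ⟨l, hl, rfl⟩
    obtain ⟨L, hL, hlL⟩ := mem_flatten.1 this
    rw [(List.mem_replicate.1 hL).2] at hlL
    exact hlL
  have hσ : ∀ l l', (sysPerm Fs₀).SameCycle l l' ↔ fin act l = fin act l' := by
    refine sameCycle_sysPerm_iff_of_covering S Fs₀ proj (fin act) (fun l => proj_bar l) ?_ ?_
      (fun l l' h1 h2 => ext_of_proj_fin act h1 h2) hStr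
    · intro l
      obtain ⟨i, hl⟩ := hface_of_mem l
      rw [prod_formPerm_apply_of_mem hd0 ((hmemFs₀ _).2 ⟨i, rfl⟩) hl,
        proj_formPerm_orbitFace act (hLd i.1) (bpt i) (hWd i) hl,
        prod_formPerm_apply_of_mem hSd (hLmem i.1) (hprojmem i l hl)]
    · intro l
      obtain ⟨i, hl⟩ := hface_of_mem l
      rw [prod_formPerm_apply_of_mem hd0 ((hmemFs₀ _).2 ⟨i, rfl⟩) hl,
        fin_formPerm_orbitFace act (S.get i.1) (bpt i) (hfix i) (hWd i) hl, fin_bar]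
  set D : (X × A) × Bool → Bool := fun l => decide (l.1 ∈ T) with hD_def
  have hD : ∀ l, D (bar l) = D l := fun l => rfl
  have htree : ∀ l l', (sysPerm Fs₀ * delPerm D hD).SameCycle l l' := by
    intro l₀
    let y : A → (X × A) × Bool := fun a =>
      if h : a = a₀ then l₀ else
        if fin act (treeLetter htr ⟨a, h⟩) = parent htr a then treeLetter htr ⟨a, h⟩
        else bar (treeLetter htr ⟨a, h⟩)
    have hne_par : ∀ a, a ≠ a₀ → a ≠ parent htr a := fun a ha e => by
      have := dist_parent_lt htr ha; rw [← e] at this; exact lt_irrefl _ this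
    have hyv : ∀ a, a ≠ a₀ → fin act (y a) = parent htr a := by
      intro a ha
      simp only [y, dif_neg ha]
      split_ifs with h
      · exact h
      · rcases fin_treeLetter_or htr ⟨a, ha⟩ with ⟨-, h2⟩ | ⟨h1, -⟩
        · exact h2
        · exact absurd h1 h
    have hyv' : ∀ a, a ≠ a₀ → fin act (bar (y a)) = a := by
      intro a ha
      simp only [y, dif_neg ha]
      split_ifs with h
      · rcases fin_treeLetter_or htr ⟨a, ha⟩ with ⟨h1, -⟩ | ⟨-, h2⟩
        · exact absurd (h1.symm.trans h) (hne_par a ha)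
        · exact h2
      · rw [bar_bar]
        rcases fin_treeLetter_or htr ⟨a, ha⟩ with ⟨h1, -⟩ | ⟨h1, -⟩
        · exact h1
        · exact absurd h1 h
    have hy1 : ∀ a (ha : a ≠ a₀), (y a).1 = arrow htr ha ∧ (bar (y a)).1 = arrow htr ha := by
      intro a ha
      simp only [y, dif_neg ha]
      split_ifs <;> simp [treeLetter, bar]
    have hDiff : ∀ x, D x = true ↔ ∃ a, a ≠ a₀ ∧ (x = y a ∨ x = bar (y a)) := by
      intro x
      simp only [hD_def, decide_eq_true_eq, hT]
      change x.1 ∈ bfsEdges htr ↔ _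
      simp only [bfsEdges, Set.mem_setOf_eq]
      constructor
      · rintro ⟨a, ha, hx⟩
        refine ⟨a, ha, ?_⟩
        obtain ⟨e, s⟩ := x
        simp only at hx
        subst hx
        have h1 := (hy1 a ha).1
        rcases hys : y a with ⟨e', s'⟩
        rw [hys] at h1
        simp only at h1
        subst h1
        cases s <;> cases s'
        · left; rfl
        · right; rfl
        · right; rfl
        · left; rfl
      · rintro ⟨a, ha, rfl | rfl⟩
        · exact ⟨a, ha, (hy1 a ha).1⟩
        · exact ⟨a, ha, (hy1 a ha).2⟩
    exact sysPerm_mul_delPerm_transitive_of_tree (sysPerm Fs₀) (fin act) hσ a₀ (dist htr) (parent htr)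
      (fun a ha => dist_parent_lt htr ha) y hyv hyv' D hD hDiff l₀
  set ρ : List ((X × A) × Bool) → List ({e : X × A // e ∉ T} × Bool) := fun V =>
    restrictWord T (V.filter fun y => !decide (y.1 ∈ T)) (fst_not_mem_of_mem_filter T V) with hρ
  set Fs : List (List ({e : X × A // e ∉ T} × Bool)) := List.ofFn fun j => ρ (W (ε.symm j)) with hFs
  have hlen : Fs.length = N := by rw [hFs, List.length_ofFn]
  set idx : Fin Fs.length → I := fun i => ε.symm (Fin.cast hlen i) with hidx
  have hget : ∀ i, Fs.get i = ρ (W (idx i)) := fun i =>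
    List.get_ofFn (fun j => ρ (W (ε.symm j))) i
  have hmap : Fs.map (List.map (inclLetter T)) = Fs₀.map fun F => F.filter fun x => !D x := by
    rw [hFs, hFs₀, List.map_ofFn, List.map_ofFn]
    congr 1
    funext j
    exact map_inclLetter_restrictWord T _ _
  have hflat : Fs.flatten.map (inclLetter T) = Fs₀.flatten.filter fun x => !D x := by
    rw [← flatten_map_map_inclLetter, hmap, List.filter_flatten]
  have hd : Fs.flatten.Nodup := by
    refine Nodup.of_map (inclLetter T) ?_
    rw [hflat]
    exact hd0.filter _
  have hDincl : ∀ l : {e : X × A // e ∉ T} × Bool, D (inclLetter T l) = false := fun l => by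
    simp only [hD_def, inclLetter, decide_eq_false_iff_not]
    exact l.1.2
  refine ⟨Fs, fun i => (idx i).1, fun i => (𝒯.t (bpt (idx i)))⁻¹, fun i => per (idx i),
    hd, ?_, ?_, ?_, ?_, ?_, ?_⟩
  · /- every letter over a surviving symbol lies on a contracted face -/
    intro l
    have h1 : inclLetter T l ∈ Fs₀.flatten.filter fun x => !D x :=
      mem_filter.2 ⟨hall0 _, by rw [hDincl]; rfl⟩
    rw [← hflat] at h1
    obtain ⟨l', hl', he⟩ := mem_map.1 h1
    rwa [← inclLetter_injective T he]
  · /- no contracted face is empty: its value in `K` is a conjugate of `c^m ≠ 1` -/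
    intro V hV hV0
    rw [hFs, List.mem_ofFn] at hV
    obtain ⟨j, rfl⟩ := hV
    set i := ε.symm j with hi
    have hval : ((Φ (FreeGroup.mk (ρ (W i))) : K) : FreeGroup X) =
        (𝒯.t (bpt i))⁻¹ * c i.1 ^ per i * 𝒯.t (bpt i) := by
      rw [hρ, ← lift_kill_mk_eq_mk_restrictWord_filter T (W i), hW, mk_orbitFace]
      exact coe_apply_lift_pathWord_of_apply_eq 𝒯 K Φ hΦ (hfix i)
    rw [hV0, show FreeGroup.mk ([] : List ({e : X × A // e ∉ T} × Bool)) = 1 from rfl, map_one,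
      OneMemClass.coe_one, eq_comm, ← inv_inv (𝒯.t (bpt i)), inv_inv (𝒯.t (bpt i))⁻¹, conj_eq_one_iff,
      hc] at hval
    simp only at hval
    rw [← mk_powWord] at hval
    exact mk_powWord_ne_one_of_transitive hSd hStr (hLmem i.1) (hLne i.1) (hper_pos i) hval
  · /- ONE VERTEX -/
    intro l l'
    refine sameCycle_sysPerm_of_inclLetter T hd ?_
    rw [hmap]
    exact sameCycle_sysPerm_filter hd0 D hD (hDincl l) (hDincl l') (htree _ _)
  · /- the rank count -/
    have h := card_nonTreeEdges_add_index 𝒯 K hKst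
    rwa [Nat.card_eq_fintype_card, Nat.card_eq_fintype_card] at h
  · /- the value of a face in Schreier's basis, and the stabiliser of its sheet -/
    intro i
    refine ⟨hper_pos (idx i), ?_, fun n => ?_⟩
    · rw [hget, hρ, ← lift_kill_mk_eq_mk_restrictWord_filter T (W (idx i)), hW, mk_orbitFace, inv_inv]
      exact coe_apply_lift_pathWord_of_apply_eq 𝒯 K Φ hΦ (hfix (idx i))
    · rw [inv_inv, hKst, map_mul, map_mul, Perm.mul_apply, Perm.mul_apply, 𝒯.t_apply, map_inv,
        Perm.inv_eq_iff_eq, 𝒯.t_apply, hact]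
      exact MulAction.zpow_smul_eq_iff_minimalPeriod_dvd
  · /- faces over a base face ↔ double cosets `K \ F / ⟨c⟩` -/
    intro f δ
    have hbridge : ∀ i : I,
        (∃ k ∈ K, ∃ z ∈ Subgroup.zpowers (c i.1), (𝒯.t (bpt i))⁻¹ = k * δ * z) ↔
        (∃ k ∈ K, ∃ z ∈ Subgroup.zpowers (c i.1), ((Quotient.out (bpt i) : FreeGroup X))⁻¹ = k * δ * z) := by
      intro i
      refine exists_mem_mul_mul_iff_of_inv_mul_mem K _ (QuotientGroup.eq.1 ?_) δ
      rw [← hcoe, 𝒯.t_apply, QuotientGroup.out_eq']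
    obtain ⟨ω, hω, huniq⟩ := CosetOrbits.existsUnique_orbit_rep_mem_doubleCoset K (c f) δ
    set i₀ : Fin Fs.length := Fin.cast hlen.symm (ε ⟨f, ω⟩) with hi₀
    have hidx₀ : idx i₀ = ⟨f, ω⟩ := by
      show ε.symm (Fin.cast hlen (Fin.cast hlen.symm (ε ⟨f, ω⟩))) = ⟨f, ω⟩
      rw [show Fin.cast hlen (Fin.cast hlen.symm (ε ⟨f, ω⟩)) = ε ⟨f, ω⟩ from Fin.ext rfl,
        Equiv.symm_apply_apply]
    refine ⟨i₀, ⟨congrArg Sigma.fst hidx₀, ?_⟩, ?_⟩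
    · beta_reduce
      rw [hidx₀]
      exact (hbridge ⟨f, ω⟩).2 hω
    · rintro i ⟨hfi, hPi⟩
      subst hfi
      have h := (hbridge (idx i)).1 hPi
      have hωi : (idx i).2 = ω := huniq _ h
      have : idx i = idx i₀ := by rw [hidx₀]; exact Sigma.ext rfl (heq_of_eq hωi)
      rw [hidx] at this
      have := congrArg Fin.val (ε.symm.injective this)
      exact Fin.ext this

end Literature.GroupTheory.CombinatorialGroupTheory
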